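import Summits.Ventures.PercRepro.RankLevelSetRuleQSumS

/-!
# PercRepro — THE THREE-TERM RECURRENCE OF THE TILTED MOMENTS `W_j(q,m) = Σ_{y ≤ m} C(m,y)/C(q+y+j, y+j)`
(p4, gen 28; C-044; paper proofs/P4-CELL-THREE.md §13.11)

`sumW q m j` (RankLevelSetRuleQSumS) is `E[t^j (1+t)^m]` for `t ~ Beta(1,q)`.  Integrating `d/dt [t^{j+1} (1+t)^{m+1} (1−t)^q]`
over `[0,1]` gives, for every `j`, the **three-term recurrence**
`(q+m+2+j)·W_{j+2} = (j+1)·W_j − (q−m−1)·W_{j+1}` (`sumW_rec`).  At the level of the finite sums it is the telescoping of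
the per-term identity `sumW_rec_term`: with `w(i,y) = C(m,y)/C(q+y+i, y+i)` and
`G(y) = q·y·C(m,y) / ((y+j+1)·C(q+y+j+1, y+j+1))`,
`(q+m+2+j)·w(j+2,y) − (j+1)·w(j,y) + (q−m−1)·w(j+1,y) = G(y) − G(y+1)`, `G(0) = G(m+1) = 0` (`G` is written out; no definition).
Together with the positivity `sumW_pos` it gives the ratio bound `sumW_ratio_lt`: `(q−m−1)·W_{j+1} < (j+1)·W_j`, the first
rung of a backward continued fraction for the ratios `W_{j+1}/W_j` (RankLevelSetRuleQMonotoneRatio).  Axioms standard.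
-/

namespace PercRepro

open Finset

/-- Every tilted moment is positive: `0 < W_j(q,m)` (a non-empty sum of positive terms). -/
theorem sumW_pos (q m j : ℕ) : 0 < sumW q m j := by
  unfold sumW
  apply Finset.sum_pos
  · intro a ha
    rw [Finset.mem_range] at ha
    apply div_pos
    · exact_mod_cast Nat.choose_pos (by omega)
    · exact_mod_cast Nat.choose_pos (by omega)
  · exact ⟨0, by simp⟩

/-- **The per-term identity behind the three-term recurrence** (for `y ≤ m`):
`(q+m+2+j)·C(m,y)/C(q+y+j+2, y+j+2) − (j+1)·C(m,y)/C(q+y+j, y+j) + (q−m−1)·C(m,y)/C(q+y+j+1, y+j+1) = G(y) − G(y+1)`. -/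
lemma sumW_rec_term (q m j y : ℕ) (hy : y ≤ m) :
    ((q : ℚ) + m + 2 + j) * ((m.choose y : ℚ) / ((q + (j + 2 + y)).choose (j + 2 + y) : ℚ))
      - ((j : ℚ) + 1) * ((m.choose y : ℚ) / ((q + (j + y)).choose (j + y) : ℚ))
      + ((q : ℚ) - m - 1) * ((m.choose y : ℚ) / ((q + (j + 1 + y)).choose (j + 1 + y) : ℚ))
    = (q : ℚ) * y * (m.choose y : ℚ) / (((y : ℚ) + j + 1) * ((q + (j + 1 + y)).choose (j + 1 + y) : ℚ))
      - (q : ℚ) * (y + 1 : ℕ) * (m.choose (y + 1) : ℚ)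
          / ((((y + 1 : ℕ) : ℚ) + j + 1) * ((q + (j + 1 + (y + 1))).choose (j + 1 + (y + 1)) : ℚ)) := by
  have hA : (0 : ℚ) < ((q + y + j).choose (y + j) : ℚ) := by
    exact_mod_cast Nat.choose_pos (by omega)
  have h1 : ((q + y + j + 1).choose (y + j + 1) : ℚ)
      = ((q : ℚ) + y + j + 1) * ((q + y + j).choose (y + j) : ℚ) / ((y : ℚ) + j + 1) := by
    have h := Nat.add_one_mul_choose_eq (q + y + j) (y + j)
    rw [eq_div_iff (by positivity)]
    exact_mod_cast h.symm
  have h2 : ((q + y + j + 2).choose (y + j + 2) : ℚ)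
      = ((q : ℚ) + y + j + 2) * ((q + y + j + 1).choose (y + j + 1) : ℚ) / ((y : ℚ) + j + 2) := by
    have h := Nat.add_one_mul_choose_eq (q + y + j + 1) (y + j + 1)
    rw [eq_div_iff (by positivity)]
    exact_mod_cast h.symm
  have h3 : (m.choose (y + 1) : ℚ) = (m.choose y : ℚ) * ((m : ℚ) - y) / ((y : ℚ) + 1) := by
    have h := Nat.choose_succ_right_eq m y
    rw [eq_div_iff (by positivity)]
    have h' : ((m.choose (y + 1) : ℕ) : ℚ) * ((y : ℚ) + 1) = ((m.choose y : ℕ) : ℚ) * (((m - y : ℕ) : ℚ)) := by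
      exact_mod_cast h
    rw [h', Nat.cast_sub hy]
  rw [show q + (j + 2 + y) = q + y + j + 2 by omega, show j + 2 + y = y + j + 2 by omega,
    show q + (j + y) = q + y + j by omega, show j + y = y + j by omega,
    show q + (j + 1 + y) = q + y + j + 1 by omega, show j + 1 + y = y + j + 1 by omega,
    show q + (j + 1 + (y + 1)) = q + y + j + 2 by omega, show j + 1 + (y + 1) = y + j + 2 by omega,
    h2, h1, h3]
  push_cast
  field_simp
  ring

/-- **The three-term recurrence of the tilted moments**: `(q+m+2+j)·W_{j+2}(q,m) = (j+1)·W_j(q,m) − (q−m−1)·W_{j+1}(q,m)`. -/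
theorem sumW_rec (q m j : ℕ) :
    ((q : ℚ) + m + 2 + j) * sumW q m (j + 2) = ((j : ℚ) + 1) * sumW q m j - ((q : ℚ) - m - 1) * sumW q m (j + 1) := by
  have key : ((q : ℚ) + m + 2 + j) * sumW q m (j + 2) - ((j : ℚ) + 1) * sumW q m j
      + ((q : ℚ) - m - 1) * sumW q m (j + 1) = 0 := by
    unfold sumW
    rw [Finset.mul_sum, Finset.mul_sum, Finset.mul_sum, ← Finset.sum_sub_distrib, ← Finset.sum_add_distrib]
    rw [Finset.sum_congr rfl (fun y hy => sumW_rec_term q m j y (by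
      rw [Finset.mem_range] at hy; omega))]
    rw [Finset.sum_range_sub' (fun y => (q : ℚ) * y * (m.choose y : ℚ)
      / (((y : ℚ) + j + 1) * ((q + (j + 1 + y)).choose (j + 1 + y) : ℚ)))]
    simp [Nat.choose_succ_self]
  linarith

/-- The first rung of the backward continued fraction: `(q−m−1)·W_{j+1} < (j+1)·W_j` (from `W_{j+2} > 0`). -/
theorem sumW_ratio_lt (q m j : ℕ) :
    ((q : ℚ) - m - 1) * sumW q m (j + 1) < ((j : ℚ) + 1) * sumW q m j := by
  have h := sumW_rec q m j
  have hpos : 0 < ((q : ℚ) + m + 2 + j) * sumW q m (j + 2) := by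
    have := sumW_pos q m (j + 2)
    positivity
  linarith

end PercRepro
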